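import Summits.Ventures.LatticeQCDFlow.Exactness.FreeFieldHMCModeAcceptance
import Mathlib.Analysis.SpecialFunctions.Trigonometric.Bounds
import HarnessLib

/-!
# A trajectory-length-free floor for HMC on one free-field mode:
# `ā(N) ≥ (2/π)·arctan(8√(1−δ²Ω²/4)/(δ²Ω²)) ≥ 1 − δ²Ω²/(4π√(1−δ²Ω²/4))` for EVERY `N`

HONEST FRAMING: exact (Metropolis-corrected) sampling algorithms for lattice gauge theory;
figures of merit are autocorrelation/cost numbers at stated couplings and volumes; no
continuum-physics claim.  (SCALAR calibration rung S0-A: not a gauge result.)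

Venture `LatticeQCDFlow` (cell pub-lqcd), topic `Exactness`; FANOUT row 2 (`s0-phi4`, HMC arm).  NEW WORK
of the cell, a corollary file of row 2's `FreeFieldHMCModeAcceptance` (the exact one-mode law
`ā(N) = (2/π)·arctan(8√(1−δ²Ω²/4)/(δ²Ω²|sin Nθ|))`, `cos θ = 1 − δ²Ω²/2`, stable regime `δΩ < 2`):
since `|sin Nθ| ≤ 1` and `arctan` is monotone, the acceptance is bounded BELOW uniformly in the
trajectory length `N` by its value at the worst phase, and `arctan x = π/2 − arctan x⁻¹ ≥ π/2 − x⁻¹`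
turns that into an explicit `1 − O(δ²)` floor.  Nothing is cited; no definition; Mathlib only
(`Real.arctan_inv_of_pos`, `Real.lt_tan`).

## What is proved (`w2 = Ω² : ℝ≥0`, `w2 ≠ 0`, `0 < δ`, `δ²Ω² < 4`, any `N : ℕ`)

* `arctan_ge_pi_div_two_sub_inv` (`0 < x`: `π/2 − 1/x ≤ arctan x`);
* **`freeModeHMC_meanAccept_ge_uniform`**: `ā(N) ≥ (2/π)·arctan(8√(1−δ²Ω²/4)/(δ²Ω²))` for every `N`
  (resonant lengths included: there `ā = 1`);
* **`freeModeHMC_meanAccept_ge_one_sub`**: `ā(N) ≥ 1 − δ²Ω²/(4π·√(1−δ²Ω²/4))` for every `N`.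

Reading for S0-A (no numerics implied beyond displayed constants): with `δΩ = 1/2` every trajectory
length is accepted on that mode with probability at least `1 − 1/(16π·√(15/16)) ≈ 0.979`; the floor is a
per-mode statement — for many modes the violations add and only the tree's sandwiches apply.  NOT
CLAIMED: `λ > 0`; several modes; optimality of the constant; any value for any run.
-/

namespace Summit.Ventures.LatticeQCDFlow.Exactness

open Real MeasureTheory ProbabilityTheory Filter Set
open Summit.Ventures.LatticeQCDFlow.Scoring
open scoped NNReal ENNReal

section ModeHMCFloor

variable {w2 : ℝ≥0}

/-- `π/2 − 1/x ≤ arctan x` for `x > 0` (`arctan x⁻¹ ≤ tan(arctan x⁻¹) = x⁻¹`). -/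
theorem arctan_ge_pi_div_two_sub_inv {x : ℝ} (hx : 0 < x) : π / 2 - 1 / x ≤ Real.arctan x := by
  have hinv : Real.arctan x⁻¹ ≤ x⁻¹ := by
    have h0 : 0 < Real.arctan x⁻¹ := Real.arctan_pos.mpr (inv_pos.mpr hx)
    have h := Real.lt_tan h0 (Real.arctan_lt_pi_div_two _)
    rw [Real.tan_arctan] at h
    exact h.le
  have heq := Real.arctan_inv_of_pos hx
  rw [one_div]
  linarith

/-- **UNIFORM-IN-`N` FLOOR**: for every trajectory length `N`,
`ā(N) ≥ (2/π)·arctan(8√(1−δ²Ω²/4)/(δ²Ω²))` — the exact law at the worst phase `|sin Nθ| = 1`. -/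
theorem freeModeHMC_meanAccept_ge_uniform (hw : w2 ≠ 0) {δ : ℝ} (hδ : 0 < δ)
    (hst : δ ^ 2 * (w2 : ℝ) < 4) (N : ℕ) :
    2 / π * Real.arctan (8 * Real.sqrt (1 - δ ^ 2 * w2 / 4) / (δ ^ 2 * w2))
      ≤ ∫ z : ℝ × ℝ, min 1 (Real.exp (-(δ ^ 2 * (w2 : ℝ) / 8 * (((lfMode δ w2)^[N] z).2 ^ 2 - z.2 ^ 2))))
          * (gaussianPDFReal 0 w2⁻¹ z.1 * gaussianPDFReal 0 1 z.2) ∂((volume : Measure ℝ).prod volume) := by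
  have hw' : (0 : ℝ) < w2 := by exact_mod_cast pos_iff_ne_zero.mpr hw
  have hπ : 0 < π := Real.pi_pos
  by_cases hsin : Real.sin (N * Real.arccos (1 - δ ^ 2 * (w2 : ℝ) / 2)) = 0
  · -- resonant length: the integral is `1 ≥ (2/π)·arctan(·)`
    rw [freeModeHMC_meanAccept_resonant hw hδ hst N hsin]
    have h1 : Real.arctan (8 * Real.sqrt (1 - δ ^ 2 * w2 / 4) / (δ ^ 2 * w2)) < π / 2 :=
      Real.arctan_lt_pi_div_two _
    calc 2 / π * Real.arctan (8 * Real.sqrt (1 - δ ^ 2 * w2 / 4) / (δ ^ 2 * w2))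
        ≤ 2 / π * (π / 2) := mul_le_mul_of_nonneg_left h1.le (by positivity)
      _ = 1 := by field_simp
  · rw [freeModeHMC_meanAccept hw hδ hst N hsin]
    obtain ⟨S, hS⟩ : ∃ S : ℝ, |Real.sin (N * Real.arccos (1 - δ ^ 2 * (w2 : ℝ) / 2))| = S := ⟨_, rfl⟩
    rw [hS]
    have hS0 : 0 < S := by rw [← hS]; exact abs_pos.mpr hsin
    have hS1 : S ≤ 1 := by rw [← hS]; exact Real.abs_sin_le_one _
    have hX : 0 ≤ 8 * Real.sqrt (1 - δ ^ 2 * w2 / 4) := by positivity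
    have hD : 0 < δ ^ 2 * (w2 : ℝ) := by positivity
    refine mul_le_mul_of_nonneg_left (Real.arctan_le_arctan_iff.mpr ?_) (by positivity)
    -- `X/D ≤ X/(D·S)` since `S ≤ 1`
    rw [div_le_div_iff₀ hD (mul_pos hD hS0)]
    calc 8 * Real.sqrt (1 - δ ^ 2 * w2 / 4) * (δ ^ 2 * w2 * S)
        = 8 * Real.sqrt (1 - δ ^ 2 * w2 / 4) * (δ ^ 2 * w2) * S := by ring
      _ ≤ 8 * Real.sqrt (1 - δ ^ 2 * w2 / 4) * (δ ^ 2 * w2) * 1 :=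
          mul_le_mul_of_nonneg_left hS1 (mul_nonneg hX hD.le)
      _ = 8 * Real.sqrt (1 - δ ^ 2 * w2 / 4) * (δ ^ 2 * w2) := mul_one _

/-- **THE `1 − O(δ²)` FLOOR, UNIFORM IN `N`**: `ā(N) ≥ 1 − δ²Ω²/(4π·√(1−δ²Ω²/4))`. -/
theorem freeModeHMC_meanAccept_ge_one_sub (hw : w2 ≠ 0) {δ : ℝ} (hδ : 0 < δ)
    (hst : δ ^ 2 * (w2 : ℝ) < 4) (N : ℕ) :
    1 - δ ^ 2 * w2 / (4 * π * Real.sqrt (1 - δ ^ 2 * w2 / 4))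
      ≤ ∫ z : ℝ × ℝ, min 1 (Real.exp (-(δ ^ 2 * (w2 : ℝ) / 8 * (((lfMode δ w2)^[N] z).2 ^ 2 - z.2 ^ 2))))
          * (gaussianPDFReal 0 w2⁻¹ z.1 * gaussianPDFReal 0 1 z.2) ∂((volume : Measure ℝ).prod volume) := by
  have hw' : (0 : ℝ) < w2 := by exact_mod_cast pos_iff_ne_zero.mpr hw
  have hπ : 0 < π := Real.pi_pos
  refine le_trans ?_ (freeModeHMC_meanAccept_ge_uniform hw hδ hst N)
  have hsv : 0 < 1 - δ ^ 2 * (w2 : ℝ) / 4 := by nlinarith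
  have hR : 0 < Real.sqrt (1 - δ ^ 2 * w2 / 4) := Real.sqrt_pos.mpr hsv
  have hD : 0 < δ ^ 2 * (w2 : ℝ) := by positivity
  have hx : 0 < 8 * Real.sqrt (1 - δ ^ 2 * w2 / 4) / (δ ^ 2 * w2) := by positivity
  have h := arctan_ge_pi_div_two_sub_inv hx
  -- `(2/π)(π/2 − D/(8R)) = 1 − D/(4πR)`
  have e : 2 / π * (π / 2 - 1 / (8 * Real.sqrt (1 - δ ^ 2 * w2 / 4) / (δ ^ 2 * w2)))
      = 1 - δ ^ 2 * w2 / (4 * π * Real.sqrt (1 - δ ^ 2 * w2 / 4)) := by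
    field_simp
    ring
  rw [← e]
  exact mul_le_mul_of_nonneg_left h (by positivity)

end ModeHMCFloor

end Summit.Ventures.LatticeQCDFlow.Exactness
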